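import Literature.AnabelianGeometry.EtaleTheta.SettingModelBTorsionTower
import HarnessLib

/-!
# The b-torsion tower — (L1) factorisation, equivariance, (L2) adapted levels, (L3) (ROUTE-PBF file T0-P1)

PROOF-ONLY.  `phi_bPow`, EQUIVARIANCE `phi_twist`, (L1) `rho_phi`, (L2) `exists_adapted` (from the tree's
`eq_one_of_forall_chi_apply_eq_top` + compactness of `Ẑ` — the only place (W) enters), (L3) `dvd_val_of_fixed`, level
descent lemmas.
Classical profinite group theory about OUR semi-synthetic `F₂hatT`; CONDITIONAL (where stated) on the displayed
tree-free hypothesis `PermBasisFixedPoints`; nothing about [EtTh]/[IUTchII]/[IUTchIII] in print; no side on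
[IUTchIII] Cor 3.12; nothing here asserts abc proved or refuted.  abc-iut-L6-t19 gen 22 (ROUTE-PBF, rung (L3′) slice 1).
-/

noncomputable section

namespace Literature.AnabelianGeometry.EtaleTheta.SettingModel.BTorsionTower

open Literature.AnabelianGeometry.EtaleTheta.SettingModel
open Literature.AnabelianGeometry.EtaleTheta (ZHatLevel.level ZHatLevel.levelChar)
open Literature.AnabelianGeometry.SemiGraphs
open Literature.AnabelianGeometry.AbsoluteAnabelian
open Literature.IUT.HodgeTheaters (profiniteCompletion toCompletion)
open CategoryTheory
open Literature.AnabelianGeometry.EtaleTheta.SettingModel.TreeFree (permHat PermBasisFixedPoints permHat_toCompletion)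

variable (n : ℕ+)

/-! ### `φ_n` on `b`-powers and the equivariance `φ_n ∘ θ_φ = k̂_{χ_n(φ),0} ∘ φ_n` -/

/-- `Ẑ → ℤ/n` is continuous. [cite: MochizukiEtTh2009, §1 p.12] -/
theorem continuous_level : Continuous (ZHatLevel.level n) := by
  refine continuous_of_continuousAt_one (ZHatLevel.level n) ?_
  rw [ContinuousAt, map_one]
  have hpure : nhds (1 : Multiplicative (ZMod n)) = pure 1 := by rw [nhds_discrete]
  rw [hpure, Filter.tendsto_pure]
  exact Filter.eventually_of_mem ((ZHatLevel.isOpen_ker_level n).mem_nhds (by simp)) (fun x hx => hx)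

/-- **`φ_n(b^t) = η_Λ(c)^{t mod n}`.** [cite: MochizukiEtTh2009, §1 p.12] -/
theorem phi_bPow (t : ZH) :
    phi n (bPow t) = etaL n (SemidirectProduct.inr (ZHatLevel.level n t)) := by
  have h := ZHatCompletion.monoidHom_ext_of_continuous
    (f₁ := (phi n).toMonoidHom.comp bPow.toMonoidHom)
    (f₂ := ((etaL n).comp SemidirectProduct.inr).comp (ZHatLevel.level n))
    ((phi n).continuous.comp bPow.continuous)
    ((continuous_of_discreteTopology
      (f := fun c : Multiplicative (ZMod n) => etaL n (SemidirectProduct.inr c))).comp (continuous_level n)) (by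
      change phi n (bPow (iotaZ (Multiplicative.ofAdd 1))) =
        etaL n (SemidirectProduct.inr (ZHatLevel.level n (iotaZ (Multiplicative.ofAdd 1))))
      rw [bPow_iotaZ_one, phi_eta_one, iotaZ_one_eq, ZHatLevel.level_eta, Int.cast_one])
  exact DFunLike.congr_fun h t

/-- **Equivariance**: `φ_n (θ_φ x) = k̂_{χ_n(φ),0} (φ_n x)`. [cite: MochizukiEtTh2009, §1 p.12] -/
theorem phi_twist (φ : MulAut ZH) (x : F₂hatT) :
    phi n (twist φ x) = affHat n (ZHatLevel.levelChar n φ) 0 (phi n x) := by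
  have h : (phi n).comp (twistEnd (φ (iotaZ (Multiplicative.ofAdd 1)))) =
      (affHat n (ZHatLevel.levelChar n φ) 0).comp (phi n) := by
    refine ext_of_eta ?_ ?_
    · change phi n (twist φ (eta (FreeGroup.of 0))) = affHat n _ 0 (phi n (eta (FreeGroup.of 0)))
      rw [twist_eta_of_zero, phi_eta_zero, affHat_etaL, aff_xL, mul_zero, add_zero]
    · change phi n (twist φ (eta (FreeGroup.of 1))) = affHat n _ 0 (phi n (eta (FreeGroup.of 1)))
      rw [twist_eta_of_one, phi_bPow, phi_eta_one, affHat_etaL, aff_inr]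
      congr 2
      rw [affRot_apply, toAdd_ofAdd, mul_one, iotaZ_one_eq, ZHatLevel.levelChar_apply, ofAdd_toAdd]
  exact DFunLike.congr_fun h x


section Factor

variable {P : ProfiniteGrp.{0}}

/-- **(L1) FACTORISATION: `ρ ∘ φ_n = ψ`.** [cite: MochizukiEtTh2009, §1 p.12] -/
theorem rho_phi (ψ : F₂hatT →ₜ* P) (hψ : ψ (eta (FreeGroup.of 1)) ^ (n : ℕ) = 1) (x : F₂hatT) :
    rho n ψ hψ (phi n x) = ψ x := by
  have h : (rho n ψ hψ).comp (phi n) = ψ := by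
    refine ext_of_eta ?_ ?_
    · change rho n ψ hψ (phi n (eta (FreeGroup.of 0))) = ψ (eta (FreeGroup.of 0))
      rw [phi_eta_zero, rho_etaL, lamPart_xL, ofAdd_zero, map_one, one_mul, inv_one, mul_one]
    · change rho n ψ hψ (phi n (eta (FreeGroup.of 1))) = ψ (eta (FreeGroup.of 1))
      rw [phi_eta_one, rho_etaL, lamPart_inr, rotPart_ofAdd_one]
  exact DFunLike.congr_fun h x

end Factor


section Adapted

variable (p : ℕ) [Fact p.Prime] (U : Subgroup (GQp p))

/-- `W_n` is closed in `Ẑ`. [cite: MochizukiEtTh2009, §1 p.12] -/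
theorem isClosed_Wset (n : ℕ+) : IsClosed (Wset p U n) := by
  have h : Wset p U n = ⋂ σ ∈ U, (fun z : ZH => ZHatLevel.level n (chi p σ z * z⁻¹)) ⁻¹' {1} := by
    ext z; simp [Wset]
  rw [h]
  refine isClosed_iInter fun σ => isClosed_iInter fun _ => IsClosed.preimage ?_ (isClosed_discrete _)
  exact (continuous_level n).comp
    (((ZHatLevel.continuous_mulEquiv (chi p σ)).1.mul continuous_id.inv))

/-- `level n y = 1` descends along `m ∣ n`. [cite: MochizukiEtTh2009, §1 p.12] -/
theorem level_eq_one_of_dvd {m n : ℕ+} (h : (m : ℕ) ∣ n) {y : ZH} (hy : ZHatLevel.level n y = 1) :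
    ZHatLevel.level m y = 1 := by
  obtain ⟨v, hv⟩ := (ZHatLevel.level_eq_one_iff_exists_pow n y).1 hy
  obtain ⟨k, hk⟩ := h
  rw [ZHatLevel.level_eq_one_iff_exists_pow]
  exact ⟨v ^ k, by rw [← pow_mul, mul_comm, ← hk, hv]⟩

/-- `W_n ⊆ W_m` for `m ∣ n`. [cite: MochizukiEtTh2009, §1 p.12] -/
theorem Wset_anti {m n : ℕ+} (h : (m : ℕ) ∣ n) : Wset p U n ⊆ Wset p U m :=
  fun _ hz σ hσ => level_eq_one_of_dvd h (hz σ hσ)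

/-- `⋂_n W_n = {1}`: an element congruent to all its `χ`-translates at every level is `χ`-fixed, hence
trivial by `H⁰(U, Ẑ(χ)) = 1` for `U` of finite index. [cite: NeukirchANT1999, Ch. II Prop. (5.7) (i)] -/
theorem eq_one_of_forall_mem_Wset [U.FiniteIndex] {z : ZH} (hz : ∀ n : ℕ+, z ∈ Wset p U n) : z = 1 := by
  apply eq_one_of_forall_chi_apply_eq p U
  intro σ hσ
  have h : chi p σ z * z⁻¹ = 1 :=
    ZHatLevel.ext_of_level fun n => by rw [hz n σ hσ, map_one]
  exact mul_inv_eq_one.mp h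

/-- **(L2) For every `N` there is a level `n`, `N ∣ n`, ADAPTED to `N`: `W_n ⊆ Ker(Ẑ → ℤ/N)`.**
[cite: NeukirchANT1999, Ch. II Prop. (5.7) (i)] -/
theorem exists_adapted [U.FiniteIndex] (N : ℕ+) :
    ∃ n : ℕ+, (N : ℕ) ∣ n ∧ Wset p U n ⊆ ((ZHatLevel.level N).ker : Set ZH) := by
  classical
  let Z : ℕ+ → Set ZH := fun n => Wset p U n ∩ ((ZHatLevel.level N).ker : Set ZH)ᶜ
  have hZc : ∀ n, IsClosed (Z n) := fun n =>
    (isClosed_Wset p U n).inter (ZHatLevel.isOpen_ker_level N).isClosed_compl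
  have hempty : (Set.univ : Set ZH) ∩ ⋂ n, Z n = ∅ := by
    rw [Set.univ_inter, Set.eq_empty_iff_forall_notMem]
    intro z hz
    rw [Set.mem_iInter] at hz
    have h1 : z = 1 := eq_one_of_forall_mem_Wset p U fun n => (hz n).1
    exact (hz N).2 (by rw [h1]; exact (ZHatLevel.level N).ker.one_mem)
  obtain ⟨t, ht⟩ := isCompact_univ.elim_finite_subfamily_closed Z hZc hempty
  refine ⟨N * ∏ m ∈ t, m, dvd_mul_right _ _, fun z hz => ?_⟩
  by_contra hzN
  have hmem : z ∈ (Set.univ : Set ZH) ∩ ⋂ m ∈ t, Z m := by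
    refine ⟨Set.mem_univ _, Set.mem_iInter₂.2 fun m hm => ⟨?_, hzN⟩⟩
    refine Wset_anti p U ?_ hz
    have hdiv : m ∣ N * ∏ m ∈ t, m := Dvd.dvd.mul_left (Finset.dvd_prod_of_mem (fun x => x) hm) N
    exact PNat.dvd_iff.1 hdiv
  rw [ht] at hmem
  exact hmem

/-- **(L3)** At a level `n` adapted to `N`, every residue `i ∈ ℤ/n` fixed by all `χ_n(σ)` is `≡ 0 (mod N)`.
[cite: NeukirchANT1999, Ch. II Prop. (5.7) (i)] -/
theorem dvd_val_of_fixed {N n : ℕ+} (had : Wset p U n ⊆ ((ZHatLevel.level N).ker : Set ZH))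
    {i : ZMod n} (hi : ∀ σ ∈ U, ZHatLevel.levelChar n (chi p σ) * i = i) : (N : ℕ) ∣ i.val := by
  haveI : NeZero (n : ℕ) := ⟨n.ne_zero⟩
  set z : ZH := ZHatLevel.eta (i.val : ℤ) with hz
  have hlz : ZHatLevel.level n z = Multiplicative.ofAdd i := by
    rw [hz, ZHatLevel.level_eta, Int.cast_natCast, ZMod.natCast_zmod_val]
  have hzW : z ∈ Wset p U n := by
    intro σ hσ
    have h := ZHatLevel.toAdd_level_aut n (chi p σ) z
    rw [hlz, toAdd_ofAdd, hi σ hσ] at h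
    rw [map_mul, map_inv, hlz, ← ofAdd_toAdd (ZHatLevel.level n (chi p σ z)), h, mul_inv_cancel]
  have hN : ZHatLevel.level N z = 1 := had hzW
  rw [hz, ZHatLevel.level_eta, ← ofAdd_zero, Multiplicative.ofAdd.apply_eq_iff_eq,
    ZMod.intCast_zmod_eq_zero_iff_dvd] at hN
  exact Int.natCast_dvd_natCast.mp hN

/-- Descent of a level equality along `m ∣ N`. [cite: MochizukiEtTh2009, §1 p.12] -/
theorem level_eq_of_dvd {m N : ℕ+} (h : (m : ℕ) ∣ N) {a b : ZH}
    (hab : ZHatLevel.level N a = ZHatLevel.level N b) : ZHatLevel.level m a = ZHatLevel.level m b := by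
  have h1 : ZHatLevel.level N (a * b⁻¹) = 1 := by rw [map_mul, map_inv, hab, mul_inv_cancel]
  have h2 := level_eq_one_of_dvd h h1
  rwa [map_mul, map_inv, mul_inv_eq_one] at h2

end Adapted

end Literature.AnabelianGeometry.EtaleTheta.SettingModel.BTorsionTower

end
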